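import Literature.MathematicalPhysics.QuantumFieldTheory.Balaban1983to89.B9Eq325RLipschitzSqrtTowerTwoBackgroundsDiagonal
import Literature.MathematicalPhysics.QuantumFieldTheory.Balaban1983to89.B9Eq325RLipschitzSqrtTowerLinear

/-!
# `Balaban1983to89.B9Eq325RLipschitzSqrtTowerTwoBackgroundsLinear` — T. Bałaban, *Propagators for lattice gauge theories in a background field*, Commun.
# Math. Phys. **99** (1985) 389–434 [Balaban1985BackgroundPropagators] p. 403 («R(U), P(U) … satisfy the same bounds»; Thm 3.4 p. 400 «analytic functions
# of U») with (3.25) p. 394, (3.16) p. 393, (3.35)–(3.37) p. 396, Thm 3.11 p. 416: **THE TWO-BACKGROUND `k`-LEVEL `R`-LETTER ON PRINT's DIAGONAL,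
# `δ`-LINEAR — `‖R_k(U)f − R_k(V)f‖ ≤ C_R⁽²⁾·δ·‖f‖` with `C_R⁽²⁾ = 3s_A⁽²⁾∕s_V` a CLOSED function of `(d, a′, M_φM_φ′, L, r, α₀)`, under the geometric
# profiles `ε_j ≤ αr^j`, `δ_j ≤ δr^j`, `α ≤ α₀`, `δ ≤ δ₀`; and GLOBALLY IN `δ` (`max(3s_A⁽²⁾∕s_V, 2∕δ₀)`, the large-`δ` branch by `‖R_k‖ ≤ 1`)** — this
# lineage's `B9Eq325RLipschitzSqrtTowerTwoBackgroundsDiagonal` §2 with the `α`-side letters FROZEN at the window `α₀` (its upper-bound binders `δ_D⁽¹⁾`,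
# `θ₁`) and the `δ`-side letters linear (`δ_D⁽²⁾ = s_Dδ`, `θ₂ = s₂δ` by `B9Eq319QprimeTowerLipschitzL2TwoBackgroundsChain.norm_QtildeTower_sub_QtildeTower_le_linear`)

statement-level skeleton of published theorems with citation tags; proofs where landed; nothing here is a claim about the Yang–Mills mass gap

PDF held: `paper:balaban1985-cmp99-background-propagators` (journal page = PDF page + 388), pp. 393–396, 400, 403, 416 — through the verbatim quotations
of the supplier files of `B9Eq325RLipschitzSqrtTowerTwoBackgroundsDiagonal` and `B9Eq325RLipschitzSqrtTowerLinear`.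

CITATION HEADER (lean-in-tree rule 2026-08-18).  Audit cell `pub-balaban`, sub-cell `t4`, NE9 crux team (2): LEAF PROVER 04
(`b2b-balaban-t4-ne9-formalise-leaf-04` gen 77), INTENT-3 — the two-background twin of this lineage's `B9Eq325RLipschitzSqrtTowerLinear` (the one-background
`hR`-slot inhabitant `‖R_k(U)f − R_k(1)f‖ ≤ (3s_A∕s♯)·α·‖f‖`).  NE9's two coupling histories give two small backgrounds; this is the `R`-letter the
two-background twins of the owner's form-defect ∕ Green ∕ `H_{1,k}` ∕ `𝔊_k` storeys will consume, with NO `η`, NO volume, NO number of levels.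

THE PRINT (verbatim, as quoted by the suppliers).  p. 403 l. 27–28: *«These results imply that the operators R(U), P(U) = I − R(U) extend analytically
to the domain (3.37) and satisfy the same bounds»*; Thm 3.4 p. 400: the operators are *«analytic functions of U»* on the small-field window — the Lipschitz
letter between two points of the window is the shadow this file types.

WHAT IS PROVED (sorry-free; 0 `def`; [folklore] real arithmetic on the closed letters of `…TwoBackgroundsDiagonal` §2; nothing of [B9] asserted).
* §1 **`norm_RofUk_sub_RofUk_le_diagonal_linear`** — on the diagonal `ηL^{n+1} = 1`, `c₀(L^{n+1})^d = c₁`, for `U`, `V` in the fine-bond window `αη`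
  (`U1`-valued, `hRS_U`, `hRS_V`), `‖U(b) − V(b)‖ ≤ δη`, level averages `Ū^j(b), V̄^j(b) ∈ U1` with `‖Ū^j(b) − 1‖, ‖V̄^j(b) − 1‖ ≤ ε_j ≤ αr^j` and
  `‖Ū^j(b) − V̄^j(b)‖ ≤ δ_j ≤ δr^j` (`j < n+1`, `0 ≤ r < 1`), `α ≤ α₀`, `δ ≤ δ₀`, with the CONSTANTS AT `(α₀, δ₀)` bound by definitional equalities
  (`s_D = √d·2M_φM_φ′`, `s_Q = 2·d(L−1)·2M_φM_φ′∕(1−r)`, `θ̄ = s_Qα₀`, `δ̄_D = s_Dα₀`, `γ = 1∕(2+2∕a′) − (δ̄_D + δ̄_D² + a′θ̄(2+θ̄))`,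
  `θ̄_G = 2δ̄_Dγ⁻¹(√γ)⁻¹ + |a′|θ̄((1+θ̄)+1)γ⁻²`, `δ̄_A = θ̄_G(1+θ̄) + (2+2∕a′)θ̄`, `s♯ = √((12d(6∕5)^{d−1} + a′)^{−2})`, `s_V = s♯ − δ̄_A`, `s₂ = 2e^{A}B` with
  `A = d(L−1)·2M_φM_φ′α₀∕(1−r)`, `B = d(L−1)·2M_φM_φ′(1+2M_φM_φ′α₀)^{d(L−1)}∕(1−r)`, `s_G⁽²⁾ = 2s_Dγ⁻¹(√γ)⁻¹ + |a′|s₂((1+θ̄)+(1+θ̄))γ⁻²`,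
  `s_A⁽²⁾ = s_G⁽²⁾(1+θ̄) + γ⁻¹s₂`) in the windows `d(L−1)·2M_φM_φ′α₀∕(1−r) ≤ 1`, `0 < γ`, `δ̄_D ≤ 1∕(2+2∕a′)`, `0 < s_V`, `Bδ₀ ≤ 1`, `2s_A⁽²⁾δ₀ ≤ s_V`:
  **`‖R_k(U)f − R_k(V)f‖ ≤ (3s_A⁽²⁾∕s_V)·δ·‖f‖`**.
* §2 **`norm_RofUk_sub_RofUk_le_diagonal_global`** — the same for EVERY `δ ≥ 0` (no `δ ≤ δ₀`; `0 < δ₀` displayed):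
  `‖R_k(U)f − R_k(V)f‖ ≤ max(3s_A⁽²⁾∕s_V, 2∕δ₀)·δ·‖f‖` — for `δ > δ₀` the two projections cost `2‖f‖ ≤ (2∕δ₀)δ‖f‖` (`B9Eq368ProjectionRemainder.norm_projR_le`).
MODEL ∕ DECLARED READINGS.  As `B9Eq325RLipschitzSqrtTowerTwoBackgroundsDiagonal`: every window ∕ profile ∕ closeness letter DISPLAYED (print's (3.35) ∕ [I]
(1.11)–(1.14) running axioms; the Lipschitz continuity of `U ↦ Ū` NOT proved); `C_R⁽²⁾` depends on the block size `L` (through `s_Q`, `B`) as print's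
constants do, NOT on `η`, the volume or the number of levels.  The `∃ α₀ δ₀ C` packaging with the windows DISCHARGED at an explicit `α₀(d, M_φM_φ′, L, r)` is
NOT in this file (next storey, cf. ne9-leaf-03's `B9Eq325RLipschitzSqrtTowerPackaged` for the one-background letter).
HONEST SCOPE.  [folklore] monotonicity-free bookkeeping (the `α`-side letters are frozen at `α₀` through the upper-bound binders of the diagonal file) +
`δ∕(s−δ) + δ∕s ≤ 3δ∕s` on `2δ ≤ s` + `‖R‖ ≤ 1`; ONE route sub-step's letter; «NE9 ⇐ the named binders»; NE9 NOT PRINTED ∕ NOT PROVED; NOT summit progress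
(cell pub-balaban: row NE9 WALLED ON A MODEL; spine PROVED 0∕9; rung (B)+1 on a finite T⁴ — NOT infinite volume, NOT mass gap, NOT BetaPertH, NOT Clay;
HONEST DEPENDENCY: continuum YM on T⁴ ⇐ BetaPertH ∧ nine spine estimates (0/9 proved); BetaPertH ⇐ (D1) ∧ (D4) ∧ CAP+tail; G-an2-4 gates asym, D1 and
NE2/3/4).  NEW file importing `…TwoBackgroundsDiagonal` + `…TowerLinear` only; nothing modified.  Net new unproved facts: 0.
-/

noncomputable section

open scoped InnerProductSpace ComplexConjugate BigOperators

namespace Literature.MathematicalPhysics.QuantumFieldTheory.Balaban1983to89.B9Eq325RLipschitzSqrtTowerTwoBackgroundsLinear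

open B4Sect5Torus (TSite)
open B9SectCLatticeCarrier (Bond)
open B9Eq311L2Pairing (WL2)
open B7Prop1Explicit (U1)
open B11Eq103H1Complex (SiteL2K)
open B9Eq310HessianOperator (adTransportW)
open B9Eq315QTower (towerP UlevOf)
open B9Eq326OperatorTower (QprimeTowerW RofUk)
open B9Eq368ProjectionRemainder (norm_projR_le)
open B9Eq319QprimeTowerLipschitzL2 (norm_QtildeTower_sub_flat_le)
open B9Eq319QprimeTowerLipschitzL2TwoBackgroundsChain (norm_QtildeTower_sub_QtildeTower_le_linear)
open B9Eq325RLipschitzSqrtTowerLinear (prod_profile_sub_one_le_linear)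
open B9Eq325RLipschitzSqrtTowerTwoBackgroundsDiagonal (norm_RofUk_sub_RofUk_le_diagonal_of_thetaQ)

variable {d : ℕ} (L : ℕ) [NeZero L] {𝔸 : Type*} [NormedRing 𝔸] [NormedAlgebra ℂ 𝔸] [CompleteSpace 𝔸] [NormOneClass 𝔸]
  {W : Type*} [NormedAddCommGroup W] [InnerProductSpace ℂ W] [FiniteDimensional ℂ W] (φ : W ≃ₗ[ℂ] 𝔸) {Mφ Mφ' : ℝ} (hMφ : 0 ≤ Mφ) (hMφ' : 0 ≤ Mφ')
  (hφ : ∀ w, ‖φ w‖ ≤ Mφ * ‖w‖) (hφ' : ∀ X, ‖φ.symm X‖ ≤ Mφ' * ‖X‖)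

section Linear

variable (m : Fin d → ℕ) [∀ i, NeZero (m i)] (n : ℕ)
  (c₀ : ℝ) [Fact (0 < c₀)] (η : ℝ) (c₁ : ℝ) [Fact (0 < c₁)] {a' : ℝ} (ha' : 0 < a')
  (hηL : η * (L : ℝ) ^ (n + 1) = 1) (hw : c₀ * ((L : ℝ) ^ (n + 1)) ^ d = c₁)
  (U V : Bond d (towerP L m (n + 1)) → 𝔸ˣ)
  (hRSU : ∀ (b : Bond d (towerP L m (n + 1))) (v u : W), ⟪adTransportW φ U b v, u⟫_ℂ = ⟪v, adTransportW φ (fun b => (U b)⁻¹) b u⟫_ℂ)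
  (hRSV : ∀ (b : Bond d (towerP L m (n + 1))) (v u : W), ⟪adTransportW φ V b v, u⟫_ℂ = ⟪v, adTransportW φ (fun b => (V b)⁻¹) b u⟫_ℂ)
  {α δ : ℝ} (hα : 0 ≤ α) (hδ : 0 ≤ δ) (hUb : ∀ b, U b ∈ U1 𝔸) (hVb : ∀ b, V b ∈ U1 𝔸) (hUε : ∀ b, ‖(U b : 𝔸) - 1‖ ≤ α * η)
  (hVε : ∀ b, ‖(V b : 𝔸) - 1‖ ≤ α * η) (hUV : ∀ b, ‖(U b : 𝔸) - (V b : 𝔸)‖ ≤ δ * η)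
  (εU δUV : ℕ → ℝ) (hεU : ∀ j, 0 ≤ εU j) (hδUV : ∀ j, 0 ≤ δUV j)
  (hLεU : ∀ (j : ℕ) (b : Bond d (towerP L m (j + 1))), ‖(UlevOf L m (n + 1) U j b : 𝔸) - 1‖ ≤ εU j)
  (hLεV : ∀ (j : ℕ) (b : Bond d (towerP L m (j + 1))), ‖(UlevOf L m (n + 1) V j b : 𝔸) - 1‖ ≤ εU j)
  (hLbU : ∀ (j : ℕ) (b : Bond d (towerP L m (j + 1))), UlevOf L m (n + 1) U j b ∈ U1 𝔸)
  (hLbV : ∀ (j : ℕ) (b : Bond d (towerP L m (j + 1))), UlevOf L m (n + 1) V j b ∈ U1 𝔸)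
  (hLUV : ∀ (j : ℕ) (b : Bond d (towerP L m (j + 1))), ‖(UlevOf L m (n + 1) U j b : 𝔸) - (UlevOf L m (n + 1) V j b : 𝔸)‖ ≤ δUV j)
  {r α₀ δ₀ : ℝ} (hr0 : 0 ≤ r) (hr1 : r < 1) (hαα₀ : α ≤ α₀)
  (hεg : ∀ j < n + 1, εU j ≤ α * r ^ j) (hδg : ∀ j < n + 1, δUV j ≤ δ * r ^ j)
  {sD sQ θb δbD γ θbG δbA sS sV s₂ sG₂ sA₂ : ℝ}
  (hsD : sD = Real.sqrt d * (2 * Mφ * Mφ'))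
  (hsQ : sQ = 2 * (((d * (L - 1) : ℕ) : ℝ) * (2 * Mφ * Mφ') / (1 - r)))
  (hθb : θb = sQ * α₀) (hδbD : δbD = sD * α₀)
  (hγdef : γ = 1 / (2 + 2 / a') - (δbD + δbD ^ 2 + a' * θb * (2 * 1 + θb)))
  (hθbG : θbG = 2 * δbD * (γ⁻¹ * (Real.sqrt γ)⁻¹) + (|a'| * θb * ((1 + θb) + 1)) * γ⁻¹ ^ 2)
  (hδbA : δbA = θbG * (1 + θb) + (2 + 2 / a') * θb)
  (hsS : sS = Real.sqrt (1 / (12 * (d : ℝ) * (6 / 5) ^ (d - 1) + a') ^ 2)) (hsV : sV = sS - δbA)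
  (hs₂ : s₂ = 2 * Real.exp ((d * (L - 1) : ℕ) * (2 * Mφ * Mφ' * α₀ / (1 - r))) *
    ((d * (L - 1) : ℕ) * (2 * Mφ * Mφ') * (1 + 2 * Mφ * Mφ' * α₀) ^ (d * (L - 1)) / (1 - r)))
  (hsG₂ : sG₂ = 2 * sD * (γ⁻¹ * (Real.sqrt γ)⁻¹) + (|a'| * s₂ * ((1 + θb) + (1 + θb))) * γ⁻¹ ^ 2)
  (hsA₂ : sA₂ = sG₂ * (1 + θb) + γ⁻¹ * s₂)
  (hc1 : ((d * (L - 1) : ℕ) : ℝ) * (2 * Mφ * Mφ') / (1 - r) * α₀ ≤ 1) (hγ : 0 < γ) (hDγ : δbD ≤ 1 / (2 + 2 / a')) (hsV0 : 0 < sV)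
  (hB : ((d * (L - 1) : ℕ) * (2 * Mφ * Mφ') * (1 + 2 * Mφ * Mφ' * α₀) ^ (d * (L - 1)) / (1 - r)) * δ₀ ≤ 1) (hwin : 2 * sA₂ * δ₀ ≤ sV)

/-! ## §1 The two-background `k`-level `R`-letter, `δ`-linear, constants frozen at `(α₀, δ₀)` -/

include hMφ hMφ' hφ hφ' ha' hηL hw hRSU hRSV hα hδ hUb hVb hUε hVε hUV hεU hδUV hLεU hLεV hLbU hLbV hLUV hr0 hr1 hαα₀ hεg hδg hsD hsQ hθb hδbD hγdef hθbG
  hδbA hsS hsV hs₂ hsG₂ hsA₂ hc1 hγ hDγ hsV0 hB hwin in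
/-- **THE TWO-BACKGROUND `k`-LEVEL `R`-LETTER, `δ`-LINEAR** — see the module docstring for the binders and the closed constants:
**`‖R_k(U)f − R_k(V)f‖ ≤ (3s_A⁽²⁾∕s_V)·δ·‖f‖`** for `δ ≤ δ₀`.  `…TwoBackgroundsDiagonal.norm_RofUk_sub_RofUk_le_diagonal_of_thetaQ` at `θ₁ := θ̄ = s_Qα₀`
(leaf-02's `norm_QtildeTower_sub_flat_le` + my `prod_profile_sub_one_le_linear`, for `U` and for `V`), `θ₂ := s₂δ` (INTENT-1's `…_le_linear` at `ε⋆ := α₀`),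
`δ_D⁽¹⁾ := s_Dα₀`, `δ_D⁽²⁾ := s_Dδ`; then `δ_A⁽²⁾ = s_A⁽²⁾δ ≤ s_V∕2` and `δ∕(s−δ) + δ∕s ≤ 3δ∕s`. NO `η`, NO volume, NO number of levels.
[cite: Balaban1985BackgroundPropagators, p.403, Thm 3.4 p.400, (3.25) p.394, (3.35)–(3.37) p.396, Thm 3.11 p.416] -/
theorem norm_RofUk_sub_RofUk_le_diagonal_linear (hδδ₀ : δ ≤ δ₀) (f : SiteL2K ℂ d (towerP L m (n + 1)) c₀ W) :
    ‖RofUk L m n φ η U (c₀ := c₀) f - RofUk L m n φ η V (c₀ := c₀) f‖ ≤ (3 * sA₂ / sV) * δ * ‖f‖ := by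
  have hK : 0 ≤ 2 * Mφ * Mφ' := by positivity
  have hα₀ : 0 ≤ α₀ := hα.trans hαα₀
  have hδ₀ : 0 ≤ δ₀ := hδ.trans hδδ₀
  have h1r : 0 < 1 - r := by linarith
  have hsD0 : 0 ≤ sD := by rw [hsD]; positivity
  have hsQ0 : 0 ≤ sQ := by rw [hsQ]; positivity
  have hθb0 : 0 ≤ θb := by rw [hθb]; positivity
  have hs₂0 : 0 ≤ s₂ := by rw [hs₂]; positivity
  have hsS0 : 0 < sS := by rw [hsS]; positivity
  have hone : Real.sqrt (c₁ / (c₀ * ((L : ℝ) ^ (n + 1)) ^ d)) = 1 := by rw [hw, div_self (Fact.out : 0 < c₁).ne', Real.sqrt_one]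
  -- `θ₁ := θ̄`: each background's tower `Q̃′`-letter against the flat one is `≤ s_Qα ≤ s_Qα₀`
  have hc1α : ((d * (L - 1) : ℕ) : ℝ) * (2 * Mφ * Mφ') / (1 - r) * α ≤ 1 := (mul_le_mul_of_nonneg_left hαα₀ (by positivity)).trans hc1
  have hprod : (∏ j ∈ Finset.range (n + 1), (1 + 2 * Mφ * Mφ' * εU j) ^ (d * (L - 1))) - 1 ≤ θb := by
    have h := prod_profile_sub_one_le_linear L n hK hr0 hr1 hα εU hεU hεg hc1α
    rw [hθb, hsQ]
    exact h.trans (mul_le_mul_of_nonneg_left hαα₀ (by positivity))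
  have hdQ1 : ∀ (X : Bond d (towerP L m (n + 1)) → 𝔸ˣ), (∀ (j : ℕ) (b : Bond d (towerP L m (j + 1))), ‖(UlevOf L m (n + 1) X j b : 𝔸) - 1‖ ≤ εU j) →
      (∀ (j : ℕ) (b : Bond d (towerP L m (j + 1))), UlevOf L m (n + 1) X j b ∈ U1 𝔸) → ∀ v : SiteL2K ℂ d (towerP L m (n + 1)) c₀ W,
      ‖((WL2.linearEquiv ℂ ℂ (fun _ : TSite d m => c₁)).symm.toLinearMap ∘ₗ QprimeTowerW L m n φ X (c₀ := c₀)) v -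
        ((WL2.linearEquiv ℂ ℂ (fun _ : TSite d m => c₁)).symm.toLinearMap ∘ₗ
          QprimeTowerW L m n φ (fun _ : Bond d (towerP L m (n + 1)) => (1 : 𝔸ˣ)) (c₀ := c₀)) v‖ ≤ θb * ‖v‖ := by
    intro X hXε hXb v
    have h := norm_QtildeTower_sub_flat_le L m n φ hMφ hMφ' hφ hφ' (c₀ := c₀) c₁ X εU hεU hXε hXb v
    rw [hone, mul_one] at h
    exact h.trans (mul_le_mul_of_nonneg_right hprod (norm_nonneg _))
  -- `θ₂ := s₂δ`: the two-background tower letter, linear (profiles read at `ε⋆ := α₀`, `δ⋆ := δ`)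
  have hεg' : ∀ j < n + 1, εU j ≤ α₀ * r ^ j := fun j hj => (hεg j hj).trans (mul_le_mul_of_nonneg_right hαα₀ (pow_nonneg hr0 j))
  have hBδ : ((d * (L - 1) : ℕ) * (2 * Mφ * Mφ') * (1 + 2 * Mφ * Mφ' * α₀) ^ (d * (L - 1)) / (1 - r)) * δ ≤ 1 :=
    (mul_le_mul_of_nonneg_left hδδ₀ (by positivity)).trans hB
  have hdQUV : ∀ v : SiteL2K ℂ d (towerP L m (n + 1)) c₀ W,
      ‖((WL2.linearEquiv ℂ ℂ (fun _ : TSite d m => c₁)).symm.toLinearMap ∘ₗ QprimeTowerW L m n φ U (c₀ := c₀)) v -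
        ((WL2.linearEquiv ℂ ℂ (fun _ : TSite d m => c₁)).symm.toLinearMap ∘ₗ QprimeTowerW L m n φ V (c₀ := c₀)) v‖ ≤ s₂ * δ * ‖v‖ := by
    intro v
    have h := norm_QtildeTower_sub_QtildeTower_le_linear L m n φ hMφ hMφ' hφ hφ' (c₀ := c₀) c₁ U V εU δUV hεU hδUV hLεU hLεV hLbU hLbV hLUV hr0 hr1
      hα₀ hδ hεg' hδg hBδ v
    rw [hone, mul_one] at h; rw [hs₂]; exact h
  -- apply the diagonal file's §2 with the frozen `α`-side letters and the linear `δ`-side letters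
  have hδD₁ : Real.sqrt d * (2 * Mφ * Mφ') * α ≤ δbD := by rw [hδbD, hsD]; exact mul_le_mul_of_nonneg_left hαα₀ (by positivity)
  have hδD₂ : Real.sqrt d * (2 * Mφ * Mφ') * δ ≤ sD * δ := by rw [hsD]
  have hwin₁ : δbA ≤ Real.sqrt (1 / (12 * (d : ℝ) * (6 / 5) ^ (d - 1) + a') ^ 2) := by rw [← hsS]; linarith [hsV0, hsV]
  set θG₂ : ℝ := 2 * (sD * δ) * (γ⁻¹ * (Real.sqrt γ)⁻¹) + (|a'| * (s₂ * δ) * ((1 + θb) + (1 + θb))) * γ⁻¹ ^ 2 with hθG₂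
  set δA₂ : ℝ := θG₂ * (1 + θb) + γ⁻¹ * (s₂ * δ) with hδA₂
  have hδA₂eq : δA₂ = sA₂ * δ := by rw [hδA₂, hθG₂, hsA₂, hsG₂]; ring
  have hsA₂0 : 0 ≤ sA₂ := by rw [hsA₂, hsG₂]; positivity
  have hδA₂0 : 0 ≤ δA₂ := by rw [hδA₂eq]; positivity
  have hδA₂half : 2 * δA₂ ≤ sV := by
    rw [hδA₂eq]; have : sA₂ * δ ≤ sA₂ * δ₀ := mul_le_mul_of_nonneg_left hδδ₀ hsA₂0
    linarith
  have hwin₂ : δA₂ < Real.sqrt (1 / (12 * (d : ℝ) * (6 / 5) ^ (d - 1) + a') ^ 2) - δbA := by rw [← hsS, ← hsV]; linarith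
  have hmain := norm_RofUk_sub_RofUk_le_diagonal_of_thetaQ L m n φ hMφ hMφ' hφ hφ' c₀ η c₁ ha' hηL hw U V hRSU hRSV hα hδ hUb hVb hUε hVε hUV hθb0
    (by positivity : 0 ≤ s₂ * δ) (hdQ1 U hLεU hLbU) (hdQ1 V hLεV hLbV) hdQUV hδD₁ hδD₂ hγdef hθbG hδbA (θG₂ := θG₂) rfl (δA₂ := δA₂) rfl hγ hDγ
    hwin₁ hwin₂ f
  rw [← hsS, ← hsV] at hmain
  -- `δ∕(s−δ) + δ∕s ≤ 3δ∕s ≤ (3s_A⁽²⁾∕s_V)·δ`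
  have hthree : δA₂ / (sV - δA₂) + δA₂ / sV ≤ 3 * δA₂ / sV := by
    have h1 : δA₂ / (sV - δA₂) ≤ δA₂ / (sV / 2) := div_le_div_of_nonneg_left hδA₂0 (by positivity) (by linarith)
    rw [div_div_eq_mul_div] at h1
    have e : 3 * δA₂ / sV = δA₂ * 2 / sV + δA₂ / sV := by ring
    rw [e]; linarith
  have hlin : 3 * δA₂ / sV = 3 * sA₂ / sV * δ := by rw [hδA₂eq]; ring
  exact hmain.trans (mul_le_mul_of_nonneg_right (hthree.trans hlin.le) (norm_nonneg _))

/-! ## §2 Globally in `δ`: the large-`δ` branch costs `2 ≤ (2∕δ₀)δ` -/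

include hMφ hMφ' hφ hφ' ha' hηL hw hRSU hRSV hα hδ hUb hVb hUε hVε hUV hεU hδUV hLεU hLεV hLbU hLbV hLUV hr0 hr1 hαα₀ hεg hδg hsD hsQ hθb hδbD hγdef hθbG
  hδbA hsS hsV hs₂ hsG₂ hsA₂ hc1 hγ hDγ hsV0 hB hwin in
/-- **THE TWO-BACKGROUND `k`-LEVEL `R`-LETTER FOR EVERY `δ ≥ 0`**: with the binders of §1 but WITHOUT `δ ≤ δ₀` (`0 < δ₀` displayed),
`‖R_k(U)f − R_k(V)f‖ ≤ max(3s_A⁽²⁾∕s_V, 2∕δ₀)·δ·‖f‖` — §1 on `δ ≤ δ₀`; for `δ₀ < δ` each `R_k` is an orthogonal projection (`norm_projR_le`), so the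
difference costs `2‖f‖ ≤ (2∕δ₀)·δ·‖f‖`.  A genuine Lipschitz letter in the closeness parameter, not only a local one.
[cite: Balaban1985BackgroundPropagators, p.403, Thm 3.4 p.400, (3.21) p.394, (3.25) p.394, Thm 3.11 p.416] -/
theorem norm_RofUk_sub_RofUk_le_diagonal_global (hδ₀ : 0 < δ₀) (f : SiteL2K ℂ d (towerP L m (n + 1)) c₀ W) :
    ‖RofUk L m n φ η U (c₀ := c₀) f - RofUk L m n φ η V (c₀ := c₀) f‖ ≤ max (3 * sA₂ / sV) (2 / δ₀) * δ * ‖f‖ := by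
  rcases le_or_gt δ δ₀ with hle | hgt
  · have h := norm_RofUk_sub_RofUk_le_diagonal_linear L φ hMφ hMφ' hφ hφ' m n c₀ η c₁ ha' hηL hw U V hRSU hRSV hα hδ hUb hVb hUε hVε hUV εU δUV hεU
      hδUV hLεU hLεV hLbU hLbV hLUV hr0 hr1 hαα₀ hεg hδg hsD hsQ hθb hδbD hγdef hθbG hδbA hsS hsV hs₂ hsG₂ hsA₂ hc1 hγ hDγ hsV0 hB hwin hle f
    exact h.trans (mul_le_mul_of_nonneg_right (mul_le_mul_of_nonneg_right (le_max_left _ _) hδ) (norm_nonneg _))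
  · have hRU : ‖RofUk L m n φ η U (c₀ := c₀) f‖ ≤ ‖f‖ := by unfold RofUk B11Eq103H1Complex.RLatticeK; exact norm_projR_le _ _ f
    have hRV : ‖RofUk L m n φ η V (c₀ := c₀) f‖ ≤ ‖f‖ := by unfold RofUk B11Eq103H1Complex.RLatticeK; exact norm_projR_le _ _ f
    have h2 : (2 : ℝ) ≤ 2 / δ₀ * δ := by rw [div_mul_eq_mul_div, le_div_iff₀ hδ₀]; linarith
    have hmax : 2 / δ₀ * δ ≤ max (3 * sA₂ / sV) (2 / δ₀) * δ := mul_le_mul_of_nonneg_right (le_max_right _ _) hδ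
    calc ‖RofUk L m n φ η U (c₀ := c₀) f - RofUk L m n φ η V (c₀ := c₀) f‖ ≤ ‖f‖ + ‖f‖ := norm_sub_le_of_le hRU hRV
      _ = 2 * ‖f‖ := by ring
      _ ≤ max (3 * sA₂ / sV) (2 / δ₀) * δ * ‖f‖ := mul_le_mul_of_nonneg_right (h2.trans hmax) (norm_nonneg _)

end Linear

/-! ## §3 The package: `∃ α₀ C` before every binder, the windows DISCHARGED at an explicit `α₀(d, M_φM_φ′, L, r)` (`a′ = 1`) -/

section Package

omit [NeZero L] in
/-- arithmetic: for `0 ≤ x ≤ 1∕16`, `0 ≤ y ≤ 1∕24`: `x + x² + y(2·1 + y) ≤ 3∕16`. [folklore] -/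
private theorem loss_le {x y : ℝ} (hx0 : 0 ≤ x) (hx : x ≤ 1 / 16) (hy0 : 0 ≤ y) (hy : y ≤ 1 / 24) : x + x ^ 2 + 1 * y * (2 * 1 + y) ≤ 3 / 16 := by
  nlinarith [mul_le_mul hx hx hx0 (by norm_num : (0:ℝ) ≤ 1 / 16), mul_le_mul hy hy hy0 (by norm_num : (0:ℝ) ≤ 1 / 24)]

include hMφ hMφ' hφ hφ' in
/-- **THE TWO-BACKGROUND `k`-LEVEL `R`-LETTER, PACKAGED — `∃ α₀ C > 0` BEFORE EVERY BINDER, FOR EVERY `δ ≥ 0`**: for `0 ≤ r < 1` there are `α₀, C > 0`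
(closed in `(d, M_φ, M_φ′, L, r)`: `α₀ = min(1∕(16s_D + 24s_Q + 1), s♯∕(2(256s_D + 1540s_Q) + 1))` at `a′ = 1`; `C = max(3s_A⁽²⁾∕s_V, 2∕δ₀)` with
`δ₀ = min(1∕(B+1), s_V∕(2s_A⁽²⁾+1))`) such that on the diagonal (`ηL^{n+1} = 1`, `c₀(L^{n+1})^d = c₁`), for every pair `U`, `V` in the fine-bond window
`αη` (`U1`-valued, `hRS_U`, `hRS_V`) with `‖U(b) − V(b)‖ ≤ δη`, level averages `U1`-valued with `‖Ū^j(b) − 1‖, ‖V̄^j(b) − 1‖ ≤ ε_j ≤ αr^j` and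
`‖Ū^j(b) − V̄^j(b)‖ ≤ δ_j ≤ δr^j` (`j < n+1`), `0 ≤ α ≤ α₀`, `0 ≤ δ`: **`‖R_k(U)f − R_k(V)f‖ ≤ C·δ·‖f‖`** — §2 with the four `α`-windows discharged
(`s_Dα₀ ≤ 1∕16`, `s_Qα₀ ≤ 1∕24` ⇒ `γ ≥ 1∕16`; `δ̄_A ≤ (256s_D + 1540s_Q)α₀ ≤ s♯∕2`) and the two `δ`-windows built into `δ₀`.  The two-background
`hR`-slot inhabitant of the NE9 chain: NO `η`, NO volume, NO number of levels. [cite: Balaban1985BackgroundPropagators, p.403, Thm 3.4 p.400, (3.25) p.394, (3.35)–(3.37) p.396, Thm 3.11 p.416] -/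
theorem exists_norm_RofUk_sub_RofUk_le_two_backgrounds {r : ℝ} (hr0 : 0 ≤ r) (hr1 : r < 1) :
    ∃ α₀ C : ℝ, 0 < α₀ ∧ 0 < C ∧ ∀ (n : ℕ) (η : ℝ), η * (L : ℝ) ^ (n + 1) = 1 → ∀ (c₀ c₁ : ℝ) [Fact (0 < c₀)] [Fact (0 < c₁)],
      c₀ * ((L : ℝ) ^ (n + 1)) ^ d = c₁ → ∀ (m : Fin d → ℕ) [∀ i, NeZero (m i)] (U V : Bond d (towerP L m (n + 1)) → 𝔸ˣ) (εU δUV : ℕ → ℝ),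
      (∀ j, 0 ≤ εU j) → (∀ j, 0 ≤ δUV j) →
      (∀ (j : ℕ) (b : Bond d (towerP L m (j + 1))), ‖(UlevOf L m (n + 1) U j b : 𝔸) - 1‖ ≤ εU j) →
      (∀ (j : ℕ) (b : Bond d (towerP L m (j + 1))), ‖(UlevOf L m (n + 1) V j b : 𝔸) - 1‖ ≤ εU j) →
      (∀ (j : ℕ) (b : Bond d (towerP L m (j + 1))), UlevOf L m (n + 1) U j b ∈ U1 𝔸) →
      (∀ (j : ℕ) (b : Bond d (towerP L m (j + 1))), UlevOf L m (n + 1) V j b ∈ U1 𝔸) →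
      (∀ (j : ℕ) (b : Bond d (towerP L m (j + 1))), ‖(UlevOf L m (n + 1) U j b : 𝔸) - (UlevOf L m (n + 1) V j b : 𝔸)‖ ≤ δUV j) →
      ∀ {α δ : ℝ}, 0 ≤ α → α ≤ α₀ → 0 ≤ δ →
      (∀ (b : Bond d (towerP L m (n + 1))) (v u : W), ⟪adTransportW φ U b v, u⟫_ℂ = ⟪v, adTransportW φ (fun b => (U b)⁻¹) b u⟫_ℂ) →
      (∀ (b : Bond d (towerP L m (n + 1))) (v u : W), ⟪adTransportW φ V b v, u⟫_ℂ = ⟪v, adTransportW φ (fun b => (V b)⁻¹) b u⟫_ℂ) →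
      (∀ b, U b ∈ U1 𝔸) → (∀ b, V b ∈ U1 𝔸) → (∀ b, ‖(U b : 𝔸) - 1‖ ≤ α * η) → (∀ b, ‖(V b : 𝔸) - 1‖ ≤ α * η) →
      (∀ b, ‖(U b : 𝔸) - (V b : 𝔸)‖ ≤ δ * η) → (∀ j < n + 1, εU j ≤ α * r ^ j) → (∀ j < n + 1, δUV j ≤ δ * r ^ j) →
      ∀ f : SiteL2K ℂ d (towerP L m (n + 1)) c₀ W, ‖RofUk L m n φ η U (c₀ := c₀) f - RofUk L m n φ η V (c₀ := c₀) f‖ ≤ C * δ * ‖f‖ := by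
  have h1r : 0 < 1 - r := by linarith
  -- the `α`-side slopes and the window `α₀` (opaque letters with their defining equations)
  obtain ⟨sD, hsD⟩ : ∃ x : ℝ, x = Real.sqrt d * (2 * Mφ * Mφ') := ⟨_, rfl⟩
  obtain ⟨sQ, hsQ⟩ : ∃ x : ℝ, x = 2 * (((d * (L - 1) : ℕ) : ℝ) * (2 * Mφ * Mφ') / (1 - r)) := ⟨_, rfl⟩
  obtain ⟨sS, hsS⟩ : ∃ x : ℝ, x = Real.sqrt (1 / (12 * (d : ℝ) * (6 / 5) ^ (d - 1) + 1) ^ 2) := ⟨_, rfl⟩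
  have hsD0 : 0 ≤ sD := by rw [hsD]; positivity
  have hsQ0 : 0 ≤ sQ := by rw [hsQ]; positivity
  have hsS0 : 0 < sS := by rw [hsS]; positivity
  obtain ⟨Sb, hSb⟩ : ∃ x : ℝ, x = 256 * sD + 1540 * sQ := ⟨_, rfl⟩
  have hSb0 : 0 ≤ Sb := by rw [hSb]; positivity
  obtain ⟨α₀, hα₀def⟩ : ∃ x : ℝ, x = min (1 / (16 * sD + 24 * sQ + 1)) (sS / (2 * Sb + 1)) := ⟨_, rfl⟩
  have hα₀pos : 0 < α₀ := by rw [hα₀def]; exact lt_min (by positivity) (by positivity)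
  have hα₀1 : α₀ ≤ 1 / (16 * sD + 24 * sQ + 1) := by rw [hα₀def]; exact min_le_left _ _
  have hα₀2 : α₀ ≤ sS / (2 * Sb + 1) := by rw [hα₀def]; exact min_le_right _ _
  have hx : sD * α₀ ≤ 1 / 16 :=
    calc sD * α₀ ≤ sD * (1 / (16 * sD + 24 * sQ + 1)) := mul_le_mul_of_nonneg_left hα₀1 hsD0
      _ = sD / (16 * sD + 24 * sQ + 1) := by ring
      _ ≤ 1 / 16 := by rw [div_le_iff₀ (by positivity)]; linarith
  have hy : sQ * α₀ ≤ 1 / 24 :=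
    calc sQ * α₀ ≤ sQ * (1 / (16 * sD + 24 * sQ + 1)) := mul_le_mul_of_nonneg_left hα₀1 hsQ0
      _ = sQ / (16 * sD + 24 * sQ + 1) := by ring
      _ ≤ 1 / 24 := by rw [div_le_iff₀ (by positivity)]; linarith
  -- the frozen letters at `α₀` (`a′ = 1`)
  obtain ⟨θb, hθb⟩ : ∃ x : ℝ, x = sQ * α₀ := ⟨_, rfl⟩
  obtain ⟨δbD, hδbD⟩ : ∃ x : ℝ, x = sD * α₀ := ⟨_, rfl⟩
  have hθb0 : 0 ≤ θb := by rw [hθb]; positivity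
  have hδbD0 : 0 ≤ δbD := by rw [hδbD]; positivity
  have hθb1 : θb ≤ 1 / 24 := by rw [hθb]; exact hy
  have hδbD1 : δbD ≤ 1 / 16 := by rw [hδbD]; exact hx
  obtain ⟨γ, hγdef⟩ : ∃ x : ℝ, x = 1 / (2 + 2 / (1:ℝ)) - (δbD + δbD ^ 2 + 1 * θb * (2 * 1 + θb)) := ⟨_, rfl⟩
  have hγge : 1 / 16 ≤ γ := by have := loss_le hδbD0 hδbD1 hθb0 hθb1; rw [hγdef]; norm_num at this ⊢; linarith
  have hγ : 0 < γ := lt_of_lt_of_le (by norm_num) hγge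
  have hDγ : δbD ≤ 1 / (2 + 2 / (1:ℝ)) := by norm_num; linarith
  have hc1 : ((d * (L - 1) : ℕ) : ℝ) * (2 * Mφ * Mφ') / (1 - r) * α₀ ≤ 1 := by
    have e : ((d * (L - 1) : ℕ) : ℝ) * (2 * Mφ * Mφ') / (1 - r) * α₀ = sQ * α₀ / 2 := by rw [hsQ]; ring
    rw [e]; linarith
  obtain ⟨θbG, hθbG⟩ : ∃ x : ℝ, x = 2 * δbD * (γ⁻¹ * (Real.sqrt γ)⁻¹) + (|(1:ℝ)| * θb * ((1 + θb) + 1)) * γ⁻¹ ^ 2 := ⟨_, rfl⟩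
  obtain ⟨δbA, hδbA⟩ : ∃ x : ℝ, x = θbG * (1 + θb) + (2 + 2 / (1:ℝ)) * θb := ⟨_, rfl⟩
  -- `γ⁻¹ ≤ 16`, `(√γ)⁻¹ ≤ 4` ⇒ `θ̄_G ≤ 128δ̄_D + 768θ̄`, `δ̄_A ≤ S̄α₀ ≤ s♯∕2`
  have hinv1 : γ⁻¹ ≤ 16 := by
    rw [inv_le_comm₀ hγ (by norm_num), show (16:ℝ)⁻¹ = 1 / 16 by norm_num]; exact hγge
  have hinv2 : (Real.sqrt γ)⁻¹ ≤ 4 := by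
    rw [inv_le_comm₀ (Real.sqrt_pos.2 hγ) (by norm_num)]
    calc (4:ℝ)⁻¹ = Real.sqrt (1 / 16) := by rw [show (1:ℝ) / 16 = (1 / 4) ^ 2 by norm_num, Real.sqrt_sq (by norm_num)]; norm_num
      _ ≤ Real.sqrt γ := Real.sqrt_le_sqrt hγge
  have hθbGle : θbG ≤ 128 * δbD + 768 * θb := by
    have h1 : γ⁻¹ * (Real.sqrt γ)⁻¹ ≤ 16 * 4 := mul_le_mul hinv1 hinv2 (by positivity) (by norm_num)
    have h2 : γ⁻¹ ^ 2 ≤ 16 ^ 2 := pow_le_pow_left₀ (by positivity) hinv1 2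
    have h3 : (1 + θb) + 1 ≤ 3 := by linarith
    have t1 : 2 * δbD * (γ⁻¹ * (Real.sqrt γ)⁻¹) ≤ 2 * δbD * (16 * 4) := mul_le_mul_of_nonneg_left h1 (by positivity)
    have t2 : θb * ((1 + θb) + 1) * γ⁻¹ ^ 2 ≤ θb * 3 * 16 ^ 2 := mul_le_mul (mul_le_mul_of_nonneg_left h3 hθb0) h2 (by positivity) (by positivity)
    rw [hθbG, abs_one, one_mul]; linarith
  have hθbG0 : 0 ≤ θbG := by rw [hθbG]; positivity
  have hδbAle : δbA ≤ Sb * α₀ := by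
    have h1 : θbG * (1 + θb) ≤ (128 * δbD + 768 * θb) * 2 := mul_le_mul hθbGle (by linarith) (by positivity) (by positivity)
    have e : Sb * α₀ = (128 * δbD + 768 * θb) * 2 + 4 * θb := by rw [hSb, hδbD, hθb]; ring
    have e4 : (2 + 2 / (1:ℝ)) = 4 := by norm_num
    rw [hδbA, e4, e]; linarith
  have hSα : Sb * α₀ ≤ sS / 2 := by
    have hne : (2 * Sb + 1) ≠ 0 := by positivity
    calc Sb * α₀ ≤ ((2 * Sb + 1) / 2) * α₀ := mul_le_mul_of_nonneg_right (by linarith) hα₀pos.le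
      _ ≤ ((2 * Sb + 1) / 2) * (sS / (2 * Sb + 1)) := mul_le_mul_of_nonneg_left hα₀2 (by positivity)
      _ = sS / 2 := by field_simp
  obtain ⟨sV, hsV⟩ : ∃ x : ℝ, x = sS - δbA := ⟨_, rfl⟩
  have hsV0 : 0 < sV := by rw [hsV]; linarith
  -- the `δ`-side slopes and the window `δ₀`
  obtain ⟨B, hBdef⟩ : ∃ x : ℝ, x = (d * (L - 1) : ℕ) * (2 * Mφ * Mφ') * (1 + 2 * Mφ * Mφ' * α₀) ^ (d * (L - 1)) / (1 - r) := ⟨_, rfl⟩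
  have hB0 : 0 ≤ B := by rw [hBdef]; positivity
  obtain ⟨s₂, hs₂⟩ : ∃ x : ℝ, x = 2 * Real.exp ((d * (L - 1) : ℕ) * (2 * Mφ * Mφ' * α₀ / (1 - r))) *
    ((d * (L - 1) : ℕ) * (2 * Mφ * Mφ') * (1 + 2 * Mφ * Mφ' * α₀) ^ (d * (L - 1)) / (1 - r)) := ⟨_, rfl⟩
  have hs₂0 : 0 ≤ s₂ := by rw [hs₂]; positivity
  obtain ⟨sG₂, hsG₂⟩ : ∃ x : ℝ, x = 2 * sD * (γ⁻¹ * (Real.sqrt γ)⁻¹) + (|(1:ℝ)| * s₂ * ((1 + θb) + (1 + θb))) * γ⁻¹ ^ 2 := ⟨_, rfl⟩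
  have hsG₂0 : 0 ≤ sG₂ := by rw [hsG₂]; positivity
  obtain ⟨sA₂, hsA₂⟩ : ∃ x : ℝ, x = sG₂ * (1 + θb) + γ⁻¹ * s₂ := ⟨_, rfl⟩
  have hsA₂0 : 0 ≤ sA₂ := by rw [hsA₂]; positivity
  obtain ⟨δ₀, hδ₀def⟩ : ∃ x : ℝ, x = min (1 / (B + 1)) (sV / (2 * sA₂ + 1)) := ⟨_, rfl⟩
  have hδ₀pos : 0 < δ₀ := by rw [hδ₀def]; exact lt_min (by positivity) (by positivity)
  have hBδ₀ : B * δ₀ ≤ 1 :=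
    calc B * δ₀ ≤ B * (1 / (B + 1)) := mul_le_mul_of_nonneg_left (by rw [hδ₀def]; exact min_le_left _ _) hB0
      _ = B / (B + 1) := by ring
      _ ≤ 1 := by rw [div_le_iff₀ (by positivity)]; linarith
  have hwin : 2 * sA₂ * δ₀ ≤ sV := by
    have hne : (2 * sA₂ + 1) ≠ 0 := by positivity
    calc 2 * sA₂ * δ₀ ≤ (2 * sA₂ + 1) * δ₀ := mul_le_mul_of_nonneg_right (by linarith) hδ₀pos.le
      _ ≤ (2 * sA₂ + 1) * (sV / (2 * sA₂ + 1)) := mul_le_mul_of_nonneg_left (by rw [hδ₀def]; exact min_le_right _ _) (by positivity)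
      _ = sV := by field_simp
  refine ⟨α₀, max (3 * sA₂ / sV) (2 / δ₀), hα₀pos, lt_max_of_lt_right (by positivity), ?_⟩
  intro n η hηL c₀ c₁ _ _ hw m _ U V εU δUV hεU hδUV hLεU hLεV hLbU hLbV hLUV α δ hα hαα₀ hδ hRSU hRSV hUb hVb hUε hVε hUV hεg hδg f
  rw [hBdef] at hBδ₀
  exact norm_RofUk_sub_RofUk_le_diagonal_global L φ hMφ hMφ' hφ hφ' m n c₀ η c₁ one_pos hηL hw U V hRSU hRSV hα hδ hUb hVb hUε hVε hUV εU δUV hεU hδUV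
    hLεU hLεV hLbU hLbV hLUV hr0 hr1 hαα₀ hεg hδg hsD hsQ hθb hδbD hγdef hθbG hδbA hsS hsV hs₂ hsG₂ hsA₂ hc1 hγ hDγ hsV0 hBδ₀ hwin hδ₀pos f

end Package

end Literature.MathematicalPhysics.QuantumFieldTheory.Balaban1983to89.B9Eq325RLipschitzSqrtTowerTwoBackgroundsLinear

end
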